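import Mathlib
import HarnessLib
import Summits.NavierStokesRegularity.NavierStokesRegularity.Theorems.TypeILiouvilleShorelineSectors
import Literature.Analysis.FluidPDE.KNSSTypeIRateLiouvilleDescent
import Literature.Analysis.FluidPDE.KNSSTypeIRateLiouvilleMild
import Literature.Analysis.FluidPDE.KNSSLiouvillePlanarHolds

/-!
# TypeILiouvilleShorelinePlanarWall — crux (L) stmt-NavierStokesRegularity-10661 `TypeIliouvilleL`:
# THE HORIZONTAL HALF OF THE 2½-D WALL ON PRINT'S CLASS (KNSS Theorem 5.1, proved in the tree)

Helper for stmt-NavierStokesRegularity-10661 (`--supports`); theorems only, no definitions, no named-fact hypotheses;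
closes no item; Navier–Stokes regularity is NOT proved here (leafhand seat of the EulerZoomLiouville route; sequel to
`TypeILiouvilleShorelineSectors`, whose `classP_translationInvariant_of_locally` feeds this file).
Class P = print's class of bounded ancient mild solutions (continuous and bounded on `(−∞,0) × ℝ³`, weakly divergence
free, Oseen integral equation).  The ignorable coordinate is the Lean index `1` (unit vector `EuclideanSpace.single 1 1`),
the horizontal components are the Lean indices `0, 2` — the tree's convention (`KNSSTypeIRateLiouvilleMild/Descent`).

* `classP_horizontal_const_of_lineInvariant` — **a class-P flow invariant under all translations along `e₁` has
  CONSTANT HORIZONTAL VELOCITY**: `v t x 0 = b₀`, `v t x 2 = b₂` for all `t < 0`, `x`.  Chain (all tree theorems):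
  class P is a bounded weak solution (`isBoundedWeakNSSolutionOn_of_oseen`); its planar trace is a bounded weak solution
  on `ℝ² × (−∞,0)` (`IsBoundedWeakNSSolutionOn.planarTrace_of_lineInvariant`); KNSS Theorem 5.1
  (`KNSS2009_liouville_planar_holds`) makes the trace `b(t)` a.e.; continuity upgrades to every `(t,x)`
  (`planar_const_of_ae_const`); the Oseen identity with `inner_integral_oseenKernel_sub_eq_zero_of_planar_const`
  (Remark 6.1 for `β + W₁e₁`) makes `b` independent of `t`.
* `classP_horizontal_const_of_locallyLineInvariant` — the same from invariance under SMALL translations along `e₁` on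
  ONE open patch of ONE slice (`classP_translationInvariant_of_locally`).
What remains of the 2½-D wall: the vertical component `v₁(t, x₀, x₂)` — a bounded ancient solution of the heat
equation with constant drift `(b₀, b₂)` in the mild (Oseen) formulation — should be constant (caloric Liouville after a
Galilean change); NOT carried out here.  [cite: KochNadirashviliSereginSverak2009, Thm. 5.1 (arXiv p. 9), Remark 6.1 (p. 11), proof of Thm. 6.2 (p. 13)]
-/

noncomputable section
open MeasureTheory Filter Set Function Metric
open scoped Topology ENNReal RealInnerProductSpace
open Literature.Analysis Literature.Analysis.FluidPDE Literature.Analysis.UnboundedOperators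
set_option linter.dupNamespace false
namespace Summit.NavierStokesRegularity.NavierStokesRegularity.Theorems.TypeILiouvilleShoreline

/-- **HORIZONTAL LIOUVILLE FOR LINE-INVARIANT MEMBERS OF PRINT'S CLASS** (KNSS Theorem 5.1 + Remark 6.1): a class-P
flow invariant under every translation along `e₁ = EuclideanSpace.single 1 1` has constant horizontal components.
[cite: KochNadirashviliSereginSverak2009, Thm. 5.1 (arXiv p. 9) and Remark 6.1 (p. 11)] -/
theorem classP_horizontal_const_of_lineInvariant
    {v : ℝ → EuclideanSpace ℝ (Fin 3) → EuclideanSpace ℝ (Fin 3)}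
    (hc : ContinuousOn (uncurry v) (Iio 0 ×ˢ univ))
    (hK : ∃ K : ℝ, ∀ t < 0, ∀ x, ‖v t x‖ ≤ K)
    (hd : ∀ t < 0, IsWeaklyDivFree (v t))
    (hm : ∀ s t : ℝ, s < t → t < 0 → ∀ x,
      v t x = heatExtension (v s) (t - s) x - oseenDuhamel 1 s v v t x)
    (hinv : ∀ t < 0, ∀ (x : EuclideanSpace ℝ (Fin 3)) (δ : ℝ), v t (x + EuclideanSpace.single 1 δ) = v t x) :
    ∃ b₀ b₂ : ℝ, ∀ t < 0, ∀ x, v t x 0 = b₀ ∧ v t x 2 = b₂ := by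
  obtain ⟨K, hKb⟩ := hK
  have hK0 : 0 ≤ K := (norm_nonneg _).trans (hKb (-1) (by norm_num) 0)
  have hvc : ∀ τ < 0, Continuous (v τ) := fun τ hτ =>
    hc.comp_continuous (Continuous.prodMk_right τ) fun x => mem_prod.2 ⟨hτ, mem_univ x⟩
  -- class P is a bounded weak solution; its planar trace is a bounded weak solution on the plane
  have hm1 : ∀ s t : ℝ, s < t → t < 0 → ∀ x,
      v t x = heatExtension (v s) (1 * (t - s)) x - oseenDuhamel 1 s v v t x := by
    intro s t hst ht x; rw [one_mul]; exact hm s t hst ht x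
  have hBW : IsBoundedWeakNSSolutionOn (Iio 0) isOpen_Iio 1 v :=
    isBoundedWeakNSSolutionOn_of_oseen one_pos hc ⟨K, hKb⟩ hd hm1
  have hV := hBW.planarTrace_of_lineInvariant hc (fun t ht x δ => hinv t ht x δ) (fun t ht => hd t ht)
  -- KNSS Theorem 5.1 on the trace, then continuity: the planar part is constant in space at every time
  obtain ⟨b, -, -, hae⟩ := KNSS2009_liouville_planar_holds hV
  have hpl : ∀ t < 0, ∀ x, v t x 0 = v t 0 0 ∧ v t x 2 = v t 0 2 := planar_const_of_ae_const hc hinv hae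
  -- Remark 6.1 for `β + W₁ e₁`: the planar components do not move in time
  have key : ∀ {m : Fin 3}, m ≠ 1 → ∀ s t : ℝ, s < t → t < 0 → ∀ x, v t x m = v s 0 m := by
    intro m hmne s t hst ht x
    have hs : s < 0 := hst.trans ht
    have hts : 0 < t - s := sub_pos.2 hst
    set e : EuclideanSpace ℝ (Fin 3) := EuclideanSpace.single m (1 : ℝ) with he
    have hcomp : ∀ w : EuclideanSpace ℝ (Fin 3), ⟪e, w⟫ = w m := fun w => by
      rw [he, EuclideanSpace.inner_single_left]; simp
    -- the free term
    have hfree : ⟪e, heatExtension (v s) (t - s) x⟫ = v s 0 m := by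
      have h1 := UnboundedOperators.heatExtension_clm_comp_of_bound (innerSL ℝ e) (hvc s hs)
        (fun z => hKb s hs z) hts x
      simp only [innerSL_apply_apply] at h1
      rw [← h1]
      have h2 : (fun z => ⟪e, v s z⟫) = fun _ => v s 0 m := by
        funext z
        rw [hcomp]
        rcases (show m = 0 ∨ m = 2 by fin_cases m <;> simp_all) with rfl | rfl
        · exact (hpl s hs z).1
        · exact (hpl s hs z).2
      rw [h2, UnboundedOperators.heatExtension_const _ hts]
    -- the Duhamel term
    have hduh : ⟪e, oseenDuhamel 1 s v v t x⟫ = 0 := by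
      have hmeas : AEStronglyMeasurable (uncurry v)
          ((volume : Measure (ℝ × EuclideanSpace ℝ (Fin 3))).restrict (Ioo s t ×ˢ univ)) := by
        refine (hc.mono ?_).aestronglyMeasurable (measurableSet_Ioo.prod MeasurableSet.univ)
        exact prod_mono (fun τ hτ => hτ.2.trans ht) subset_rfl
      have hKτ : ∀ τ ∈ Ioo s t, ∀ y, ‖v τ y‖ ≤ K := fun τ hτ y => hKb τ (hτ.2.trans ht) y
      have hint := integrable_oseenKernel_duhamel_bounded one_pos hmeas hmeas hK0 hKτ hKτ hst
        le_rfl x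
      rw [volume_restrict_prod_univ_eq_prod] at hint
      have hF : Integrable (fun τ => ∫ y, oseenKernel (1 * (t - τ)) (x - y) (v τ y) (v τ y))
          (volume.restrict (Ioo s t)) := hint.integral_prod_left
      rw [oseenDuhamel_apply, ← integral_inner hF e]
      refine setIntegral_eq_zero_of_forall_eq_zero fun τ hτ => ?_
      have hτ0 : τ < 0 := hτ.2.trans ht
      have hσ : 0 < 1 * (t - τ) := by rw [one_mul]; exact sub_pos.2 hτ.2
      rw [real_inner_comm]
      exact inner_integral_oseenKernel_sub_eq_zero_of_planar_const hσ (hvc τ hτ0)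
        (fun y => hKb τ hτ0 y) (fun y δ => hinv τ hτ0 y δ) (fun y => hpl τ hτ0 y) x hmne
    rw [← hcomp, hm s t hst ht x, inner_sub_right, hfree, hduh, sub_zero]
  -- connect every time to the reference time through a common earlier time
  refine ⟨v (-1) 0 0, v (-1) 0 2, fun t ht x => ?_⟩
  set s : ℝ := min t (-1) - 1 with hs
  have hst : s < t := by rw [hs]; linarith [min_le_left t (-1)]
  have hs1 : s < -1 := by rw [hs]; linarith [min_le_right t (-1)]
  have h0 := key (show (0 : Fin 3) ≠ 1 by decide) s t hst ht x
  have h0' := key (show (0 : Fin 3) ≠ 1 by decide) s (-1) hs1 (by norm_num) 0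
  have h2 := key (show (2 : Fin 3) ≠ 1 by decide) s t hst ht x
  have h2' := key (show (2 : Fin 3) ≠ 1 by decide) s (-1) hs1 (by norm_num) 0
  exact ⟨h0.trans h0'.symm, h2.trans h2'.symm⟩

/-- **LOCALLY LINE-INVARIANT ON ONE PATCH OF ONE SLICE ⟹ CONSTANT HORIZONTAL VELOCITY EVERYWHERE.**  If
`v t₀ (x + s•e₁) = v t₀ x` for `x` in one nonempty open set and all `|s| < δ` (`t₀ < 0`), the class-P flow is invariant
under every translation along `e₁` (`classP_translationInvariant_of_locally`) and its horizontal components are two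
constants (`classP_horizontal_const_of_lineInvariant`).  Residual of this stratum: the vertical component, a bounded
ancient caloric function with constant drift (expected constant; not proved here).
[cite: KochNadirashviliSereginSverak2009, Thm. 5.1 (arXiv p. 9); LemarieRieusset2016, Thm. 9.12] -/
theorem classP_horizontal_const_of_locallyLineInvariant
    {v : ℝ → EuclideanSpace ℝ (Fin 3) → EuclideanSpace ℝ (Fin 3)}
    (hc : ContinuousOn (uncurry v) (Iio 0 ×ˢ univ))
    (hK : ∃ K : ℝ, ∀ t < 0, ∀ x, ‖v t x‖ ≤ K)
    (hd : ∀ t < 0, IsWeaklyDivFree (v t))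
    (hm : ∀ s t : ℝ, s < t → t < 0 → ∀ x,
      v t x = heatExtension (v s) (t - s) x - oseenDuhamel 1 s v v t x)
    {t₀ δ : ℝ} (ht₀ : t₀ < 0) (hδ : 0 < δ)
    {U : Set (EuclideanSpace ℝ (Fin 3))} (hUo : IsOpen U) (hUne : U.Nonempty)
    (h : ∀ s ∈ Ioo (-δ) δ, ∀ x ∈ U, v t₀ (x + s • EuclideanSpace.single 1 (1 : ℝ)) = v t₀ x) :
    ∃ b₀ b₂ : ℝ, ∀ t < 0, ∀ x, v t x 0 = b₀ ∧ v t x 2 = b₂ := by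
  have hglob := classP_translationInvariant_of_locally hc hK hm (EuclideanSpace.single 1 (1 : ℝ)) ht₀ hδ hUo hUne h
  refine classP_horizontal_const_of_lineInvariant hc hK hd hm fun t ht x s => ?_
  have hsingle : EuclideanSpace.single (1 : Fin 3) s = s • EuclideanSpace.single (1 : Fin 3) (1 : ℝ) := by
    ext i
    by_cases hi : i = 1
    · subst hi; simp
    · simp [hi]
  rw [hsingle]
  exact hglob t ht s x

end Summit.NavierStokesRegularity.NavierStokesRegularity.Theorems.TypeILiouvilleShoreline

end
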